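import Summits.NavierStokesRegularity.NavierStokesRegularity.Theorems.TypeIIInviscidRelaxationAxisymSwirlRegularCoreReynoldsPlateau
import HarnessLib

/-!
# Two-level inflow criterion with an ARBITRARILY THIN subcritical core — ANY outer level

Helper toward the crux `OneSidedRadialCriterion` (stmt-NavierStokesRegularity-19059; line `subcritical_core_reynolds`,
registered stub `stub_subcriticalCoreReynolds`), criterion side; continues `…CoreReynoldsPlateau.lean` (criterion with
the plateau Reynolds profile `D = 2 − N + M/N + ε²s²(N−2m)/(2N)`, `N = 2m + 2a/(1+s²) + bL/(1+s^L)`,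
`M = 4as²/(1+s²)² + bL²s^L/(1+s^L)²`, `s = ξ/ε`, `p = 2m + 2a + Lb`).

* `plateau_core_alg` / `plateau_zoneA_alg` / `plateau_zoneB_alg` — with `N = 2m + α + β`: `D ≥ 2 − N`;
  `D ≥ L/4` where `β ≥ 2m + α` and `M ≥ Lβ/2` (PLATEAU); `D ≥ ε²s²α/(4(2m+α))` always (similarity GAIN);
* `exists_plateau_params` — for `0 < p < 2`, ANY `Λ₀ > 0`, ANY `ξ₀ > 0`: `ε = ξ₀`, `L = 4Λ₀`, `Q = (√(8Λ₀)/ξ₀)^L`,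
  `m = p/(8(1+Q)(1+16Λ₀/ξ₀²))`, `a = 16mΛ₀/ξ₀²`, `b = (p−2m−2a)/L` give `D ≥ Λ₀` on `ξ ≥ ξ₀` (on `1 ≤ s ≤ √(8Λ₀)/ε`
  the `bL`-term dominates `N`: plateau; beyond, plateau or gain `≥ min(ε²s²/8, ε²a/(16m)) = Λ₀`);
* `plateauReynolds_ge_core` — `D ≥ 2 − p` everywhere;
* `twoLevelReynolds_thinCore_anyLevel` — **for every core level `d₀ < 2`, EVERY outer level `Λ₀` and EVERY core
  width `ξ₀ > 0`**: Reynolds number `≤ d₀` where `r < ξ₀√(ν(T−t))`, `≤ Λ₀` where `r ≥ ξ₀√(ν(T−t))` (unit tube,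
  standing class) ⇒ continuation.  Removes both the dictated width of the tree's `exists_coreWidth_twoLevelReynolds`
  and the cap `Λ₀ < 4` of `RadialInflowThinCore.twoLevelReynolds_thinCore`.

Reading for ⟨19059⟩ (ANY gate constant `C`): the registered stub's «subcritical in EVERY parabolic core» may be replaced
by «subcritical in SOME parabolic core, however thin» (next file, on the stub's exact hypothesis list); equivalently a
gated singularity must carry inflow Reynolds numbers `≥ 2 − o(1)` at points with `r/√(ν(T−t)) → 0`.  Honest label: a
regularity CRITERION (comparison method, Hölder exponent `2m` of the resulting swirl modulus exponentially small in
`Λ₀`); the open half `C ≥ 2` of ⟨19059⟩ is untouched; nothing here proves `OneSidedRadialCriterion`,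
`AxisymSwirlRegular` or NavierStokesRegularity. [new]
-/

noncomputable section

set_option linter.dupNamespace false

open Set Filter Topology Real
open Literature.Analysis.FluidPDE

namespace Summit.NavierStokesRegularity.NavierStokesRegularity.Theorems.RadialInflowPlateau

open Summit.NavierStokesRegularity.NavierStokesRegularity.Theorems
open Summit.NavierStokesRegularity.NavierStokesRegularity.Theorems.ZhangBarrier

/-! ## §1 Algebra of the plateau Reynolds profile `D = 2 − N + M/N + ε²s²(N − 2m)/(2N)`, `N = 2m + α + β` -/

/-- Core level: `D ≥ 2 − N` (`M ≥ 0`, `N ≥ 2m > 0`). -/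
theorem plateau_core_alg {m α β M ε s : ℝ} (hm : 0 < m) (hα : 0 ≤ α) (hβ : 0 ≤ β) (hM : 0 ≤ M) :
    2 - (2 * m + α + β) ≤ 2 - (2 * m + α + β) + M / (2 * m + α + β)
      + ε ^ 2 * s ^ 2 * ((2 * m + α + β) - 2 * m) / (2 * (2 * m + α + β)) := by
  have hN : 0 < 2 * m + α + β := by linarith
  have h1 : 0 ≤ M / (2 * m + α + β) := div_nonneg hM hN.le
  have h2 : 0 ≤ ε ^ 2 * s ^ 2 * ((2 * m + α + β) - 2 * m) / (2 * (2 * m + α + β)) := by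
    apply div_nonneg _ (by positivity)
    have : 0 ≤ (2 * m + α + β) - 2 * m := by linarith
    positivity
  linarith

/-- Plateau zone: `β ≥ 2m + α`, `M ≥ Lβ/2`, `N ≤ 2` ⇒ `D ≥ L/4`. -/
theorem plateau_zoneA_alg {m α β M L ε s : ℝ} (hm : 0 < m) (hα : 0 ≤ α) (hL : 0 ≤ L) (hdom : 2 * m + α ≤ β)
    (hM : L * β / 2 ≤ M) (hN2 : 2 * m + α + β ≤ 2) :
    L / 4 ≤ 2 - (2 * m + α + β) + M / (2 * m + α + β)
      + ε ^ 2 * s ^ 2 * ((2 * m + α + β) - 2 * m) / (2 * (2 * m + α + β)) := by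
  have hβ : 0 < β := by linarith
  have hN : 0 < 2 * m + α + β := by linarith
  have h1 : L / 4 ≤ M / (2 * m + α + β) := by
    rw [div_le_div_iff₀ (by norm_num) hN]
    nlinarith
  have h2 : 0 ≤ ε ^ 2 * s ^ 2 * ((2 * m + α + β) - 2 * m) / (2 * (2 * m + α + β)) := by
    apply div_nonneg _ (by positivity)
    have : 0 ≤ (2 * m + α + β) - 2 * m := by linarith
    positivity
  linarith

/-- Gain (everywhere): `M ≥ 0`, `N ≤ 2` ⇒ `D ≥ ε²s²α/(4(2m+α))`. -/
theorem plateau_zoneB_alg {m α β M ε s : ℝ} (hm : 0 < m) (hα : 0 ≤ α) (hβ : 0 ≤ β)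
    (hM : 0 ≤ M) (hN2 : 2 * m + α + β ≤ 2) :
    ε ^ 2 * s ^ 2 * α / (4 * (2 * m + α)) ≤ 2 - (2 * m + α + β) + M / (2 * m + α + β)
      + ε ^ 2 * s ^ 2 * ((2 * m + α + β) - 2 * m) / (2 * (2 * m + α + β)) := by
  have hN : 0 < 2 * m + α + β := by linarith
  have hP : 0 < 2 * m + α := by linarith
  have h1 : 0 ≤ M / (2 * m + α + β) := div_nonneg hM hN.le
  have h2 : ε ^ 2 * s ^ 2 * α / (4 * (2 * m + α))
      ≤ ε ^ 2 * s ^ 2 * ((2 * m + α + β) - 2 * m) / (2 * (2 * m + α + β)) := by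
    rw [div_le_div_iff₀ (by positivity) (by positivity)]
    have hes : 0 ≤ ε ^ 2 * s ^ 2 := by positivity
    -- `α · 2N ≤ (α+β) · 4(2m+α)` since `N ≤ 2(2m+α)` and `α ≤ α + β`
    have h3 : α * (2 * (2 * m + α + β)) ≤ ((2 * m + α + β) - 2 * m) * (4 * (2 * m + α)) := by nlinarith
    nlinarith [mul_le_mul_of_nonneg_left h3 hes]
  linarith

/-! ## §2 Parameters for any outer level and any core width -/

/-- **Parameters.** For `0 < p < 2`, ANY outer level `Λ₀ > 0` and ANY core width `ξ₀ > 0` there are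
`m, a, b, L, ε` (`0 < m`, `2m ≤ 1`, `0 ≤ a`, `0 ≤ b`, `0 < L`, `p = 2m + 2a + Lb`, `ε > 0`) such that the plateau
Reynolds profile is `≥ Λ₀` at every `ξ ≥ ξ₀`.  Choice: `ε = ξ₀`, `L = 4Λ₀`, `Q = (√(8Λ₀)/ξ₀)^L`,
`m = p/(8(1+Q)(1+16Λ₀/ξ₀²))`, `a = 16mΛ₀/ξ₀²`, `b = (p − 2m − 2a)/L`: for `1 ≤ s ≤ √(8Λ₀)/ε` the `bL`-term dominates
`N` (plateau, level `≥ L/4`); beyond, either it still does or the similarity gain gives `≥ min(ε²s²/8, ε²a/(16m)) = Λ₀`.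
[new] -/
theorem exists_plateau_params {p Λ₀ ξ₀ : ℝ} (hp : 0 < p) (hp2 : p < 2) (hΛ : 0 < Λ₀) (hξ₀ : 0 < ξ₀) :
    ∃ m a b L ε : ℝ, 0 < m ∧ 2 * m ≤ 1 ∧ 0 ≤ a ∧ 0 ≤ b ∧ 0 < L ∧ p = 2 * m + 2 * a + L * b ∧ 0 < ε ∧
      ∀ ξ : ℝ, ξ₀ ≤ ξ →
        Λ₀ ≤ 2 - (2 * m + 2 * a / (1 + (ξ / ε) ^ 2) + b * L / (1 + (ξ / ε) ^ L))
          + (4 * a * (ξ / ε) ^ 2 / (1 + (ξ / ε) ^ 2) ^ 2 + b * L ^ 2 * (ξ / ε) ^ L / (1 + (ξ / ε) ^ L) ^ 2)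
            / (2 * m + 2 * a / (1 + (ξ / ε) ^ 2) + b * L / (1 + (ξ / ε) ^ L))
          + ε ^ 2 * (ξ / ε) ^ 2 * ((2 * m + 2 * a / (1 + (ξ / ε) ^ 2) + b * L / (1 + (ξ / ε) ^ L)) - 2 * m)
            / (2 * (2 * m + 2 * a / (1 + (ξ / ε) ^ 2) + b * L / (1 + (ξ / ε) ^ L))) := by
  set L : ℝ := 4 * Λ₀ with hL_def
  clear_value L
  have hL : 0 < L := by rw [hL_def]; positivity
  set s₁ : ℝ := √(8 * Λ₀) / ξ₀ with hs₁_def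
  clear_value s₁
  have hs₁ : 0 < s₁ := by rw [hs₁_def]; exact div_pos (Real.sqrt_pos.2 (by positivity)) hξ₀
  have hs₁sq : s₁ ^ 2 = 8 * Λ₀ / ξ₀ ^ 2 := by
    rw [hs₁_def, div_pow, Real.sq_sqrt (by positivity)]
  set Q : ℝ := s₁ ^ L with hQ_def
  clear_value Q
  have hQ : 0 < Q := by rw [hQ_def]; exact Real.rpow_pos_of_pos hs₁ L
  set K : ℝ := 1 + 16 * Λ₀ / ξ₀ ^ 2 with hK_def
  clear_value K
  have hK : 1 ≤ K := by rw [hK_def]; exact le_add_of_nonneg_right (by positivity)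
  set m : ℝ := p / (8 * (1 + Q) * K) with hm_def
  clear_value m
  have hm : 0 < m := by rw [hm_def]; positivity
  have hmK : 2 * m * K = p / (4 * (1 + Q)) := by rw [hm_def]; field_simp; ring
  have hmK' : 2 * m * K ≤ p / 4 := by
    rw [hmK]
    exact div_le_div_of_nonneg_left hp.le (by norm_num) (by linarith)
  set a : ℝ := 16 * m * Λ₀ / ξ₀ ^ 2 with ha_def
  clear_value a
  have ha : 0 ≤ a := by rw [ha_def]; positivity
  have h2m2a : 2 * m + 2 * a = 2 * m * K := by rw [ha_def, hK_def]; field_simp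
  set b : ℝ := (p - 2 * m - 2 * a) / L with hb_def
  clear_value b
  have hbL : b * L = p - 2 * m - 2 * a := by rw [hb_def]; field_simp
  have hb : 0 ≤ b := by rw [hb_def]; apply div_nonneg _ hL.le; linarith
  have hm1 : 2 * m ≤ 1 := by
    have : 2 * m ≤ 2 * m * K := le_mul_of_one_le_right (by positivity) hK
    linarith
  refine ⟨m, a, b, L, ξ₀, hm, hm1, ha, hb, hL, by linarith, hξ₀, fun ξ hξ => ?_⟩
  have hξpos : 0 < ξ := hξ₀.trans_le hξ
  set s : ℝ := ξ / ξ₀ with hs_def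
  clear_value s
  have hs1 : 1 ≤ s := by rw [hs_def, le_div_iff₀ hξ₀]; linarith
  have hs : 0 < s := by linarith
  have hsL1 : 1 ≤ s ^ L := Real.one_le_rpow hs1 hL.le
  have hsL : 0 < s ^ L := by linarith
  -- abbreviations
  set α : ℝ := 2 * a / (1 + s ^ 2) with hα_def
  clear_value α
  set β : ℝ := b * L / (1 + s ^ L) with hβ_def
  clear_value β
  set M : ℝ := 4 * a * s ^ 2 / (1 + s ^ 2) ^ 2 + b * L ^ 2 * s ^ L / (1 + s ^ L) ^ 2 with hM_def
  clear_value M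
  have hα : 0 ≤ α := by rw [hα_def]; positivity
  have hβ : 0 ≤ β := by rw [hβ_def]; positivity
  have hM : 0 ≤ M := by rw [hM_def]; positivity
  have hα2a : α ≤ 2 * a := by
    rw [hα_def]; exact div_le_self (by positivity) (by nlinarith [sq_nonneg s])
  have hβbL : β ≤ b * L := by
    rw [hβ_def]; exact div_le_self (by positivity) (by linarith)
  have hN2 : 2 * m + α + β ≤ 2 := by linarith
  -- `M ≥ Lβ/2` (uses `s^L ≥ 1`)
  have hMβ : L * β / 2 ≤ M := by
    set y : ℝ := s ^ L with hy_def
    clear_value y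
    have hy1 : 0 < 1 + y := by linarith
    have hbL2 : 0 ≤ b * L ^ 2 := by positivity
    have h1 : L * β / 2 ≤ b * L ^ 2 * y / (1 + y) ^ 2 := by
      have e1 : L * β / 2 = b * L ^ 2 / (2 * (1 + y)) := by rw [hβ_def]; field_simp
      rw [e1, div_le_div_iff₀ (by positivity) (by positivity)]
      have key : b * L ^ 2 * y * (2 * (1 + y)) - b * L ^ 2 * (1 + y) ^ 2 = b * L ^ 2 * ((1 + y) * (y - 1)) := by
        ring
      have hnn : 0 ≤ b * L ^ 2 * ((1 + y) * (y - 1)) :=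
        mul_nonneg hbL2 (mul_nonneg hy1.le (by linarith))
      linarith
    have h2 : 0 ≤ 4 * a * s ^ 2 / (1 + s ^ 2) ^ 2 := by positivity
    linarith
  -- rewrite the goal in terms of `α, β, M` (`ξ/ξ₀ = s`)
  show Λ₀ ≤ 2 - (2 * m + α + β) + M / (2 * m + α + β)
      + ξ₀ ^ 2 * s ^ 2 * ((2 * m + α + β) - 2 * m) / (2 * (2 * m + α + β))
  by_cases hdom : 2 * m + α ≤ β
  · -- plateau zone
    have h := plateau_zoneA_alg (ε := ξ₀) (s := s) hm hα hL.le hdom hMβ hN2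
    have : L / 4 = Λ₀ := by rw [hL_def]; ring
    linarith
  · push Not at hdom
    -- then `s ≥ s₁`: on `[1, s₁]` the `bL`-term dominates
    have hss₁ : s₁ ≤ s := by
      by_contra hlt
      push Not at hlt
      have hQs : s ^ L ≤ Q := by rw [hQ_def]; exact Real.rpow_le_rpow hs.le hlt.le hL.le
      have hβlow : b * L / (1 + Q) ≤ β := by
        rw [hβ_def]; exact div_le_div_of_nonneg_left (by positivity) (by positivity) (by linarith)
      have hbL4 : p / 4 ≤ b * L := by rw [hbL]; linarith
      have hkey : 2 * m + 2 * a ≤ b * L / (1 + Q) := by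
        rw [h2m2a, hmK]
        have e : p / (4 * (1 + Q)) = (p / 4) / (1 + Q) := by field_simp
        rw [e]
        exact div_le_div_of_nonneg_right hbL4 (by positivity)
      linarith
    have hB := plateau_zoneB_alg (ε := ξ₀) (s := s) hm hα hβ hM hN2
    -- the gain is `≥ Λ₀`
    have hgain : Λ₀ ≤ ξ₀ ^ 2 * s ^ 2 * α / (4 * (2 * m + α)) := by
      have hP : 0 < 2 * m + α := by linarith
      rw [le_div_iff₀ (by positivity)]
      rcases le_or_gt (2 * m) α with hcase | hcase
      · -- `α ≥ 2m`: gain `≥ ξ₀² s²/8 ≥ ξ₀² s₁²/8 = Λ₀`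
        have h1 : ξ₀ ^ 2 * s₁ ^ 2 ≤ ξ₀ ^ 2 * s ^ 2 :=
          mul_le_mul_of_nonneg_left (pow_le_pow_left₀ hs₁.le hss₁ 2) (by positivity)
        have h2 : ξ₀ ^ 2 * s₁ ^ 2 = 8 * Λ₀ := by rw [hs₁sq]; field_simp
        have hA : Λ₀ * (4 * (2 * m + α)) ≤ Λ₀ * (8 * α) :=
          mul_le_mul_of_nonneg_left (by linarith) hΛ.le
        have hB : Λ₀ * (8 * α) ≤ ξ₀ ^ 2 * s ^ 2 * α := by
          rw [show Λ₀ * (8 * α) = (8 * Λ₀) * α by ring]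
          exact mul_le_mul_of_nonneg_right (by linarith) hα
        linarith
      · -- `α ≤ 2m`: gain `≥ ξ₀² s² α/(16m) ≥ ξ₀² a/(16 m) = Λ₀`
        have hs2 : 1 ≤ 2 * s ^ 2 / (1 + s ^ 2) := by
          have : 1 ≤ s ^ 2 := one_le_pow₀ hs1
          rw [le_div_iff₀ (by positivity)]; linarith
        have h1 : a ≤ s ^ 2 * α := by
          rw [hα_def, show s ^ 2 * (2 * a / (1 + s ^ 2)) = a * (2 * s ^ 2 / (1 + s ^ 2)) by ring]
          exact le_mul_of_one_le_right ha hs2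
        have h2 : ξ₀ ^ 2 * a = 16 * m * Λ₀ := by rw [ha_def]; field_simp [hξ₀.ne']
        have hA : Λ₀ * (4 * (2 * m + α)) ≤ Λ₀ * (16 * m) :=
          mul_le_mul_of_nonneg_left (by linarith) hΛ.le
        have hB : ξ₀ ^ 2 * a ≤ ξ₀ ^ 2 * (s ^ 2 * α) := mul_le_mul_of_nonneg_left h1 (by positivity)
        have e3 : ξ₀ ^ 2 * (s ^ 2 * α) = ξ₀ ^ 2 * s ^ 2 * α := by ring
        linarith
    linarith

/-! ## §3 The two-level criterion with an arbitrarily thin subcritical core, ANY outer level -/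

/-- **Core level on the literal profile:** `D(ξ) ≥ 2 − p` for every `ξ`, `ε > 0` (`p = 2m + 2a + Lb`). [new] -/
theorem plateauReynolds_ge_core {m a b L ε : ℝ} (hm : 0 < m) (ha : 0 ≤ a) (hb : 0 ≤ b) (hL : 0 < L) (hε : 0 < ε)
    {ξ : ℝ} (hξ : 0 ≤ ξ) :
    2 - (2 * m + 2 * a + L * b)
      ≤ 2 - (2 * m + 2 * a / (1 + (ξ / ε) ^ 2) + b * L / (1 + (ξ / ε) ^ L))
          + (4 * a * (ξ / ε) ^ 2 / (1 + (ξ / ε) ^ 2) ^ 2 + b * L ^ 2 * (ξ / ε) ^ L / (1 + (ξ / ε) ^ L) ^ 2)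
            / (2 * m + 2 * a / (1 + (ξ / ε) ^ 2) + b * L / (1 + (ξ / ε) ^ L))
          + ε ^ 2 * (ξ / ε) ^ 2 * ((2 * m + 2 * a / (1 + (ξ / ε) ^ 2) + b * L / (1 + (ξ / ε) ^ L)) - 2 * m)
            / (2 * (2 * m + 2 * a / (1 + (ξ / ε) ^ 2) + b * L / (1 + (ξ / ε) ^ L))) := by
  set s : ℝ := ξ / ε with hs_def
  clear_value s
  have hs : 0 ≤ s := by rw [hs_def]; exact div_nonneg hξ hε.le
  have hsL : 0 ≤ s ^ L := Real.rpow_nonneg hs L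
  set α : ℝ := 2 * a / (1 + s ^ 2) with hα_def
  clear_value α
  set β : ℝ := b * L / (1 + s ^ L) with hβ_def
  clear_value β
  set M : ℝ := 4 * a * s ^ 2 / (1 + s ^ 2) ^ 2 + b * L ^ 2 * s ^ L / (1 + s ^ L) ^ 2 with hM_def
  clear_value M
  have hα : 0 ≤ α := by rw [hα_def]; positivity
  have hβ : 0 ≤ β := by rw [hβ_def]; positivity
  have hM : 0 ≤ M := by rw [hM_def]; positivity
  have hα2a : α ≤ 2 * a := by
    rw [hα_def]; exact div_le_self (by positivity) (by nlinarith [sq_nonneg s])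
  have hβbL : β ≤ b * L := by
    rw [hβ_def]; exact div_le_self (by positivity) (by linarith)
  have h := plateau_core_alg (ε := ε) (s := s) hm hα hβ hM
  linarith

/-- **Two-level inflow criterion with an arbitrarily thin subcritical core — ANY outer level.**  For every core level
`0 < d₀ < 2`, EVERY outer level `Λ₀ > 0` and EVERY core width `ξ₀ > 0`: an axisymmetric classical Leray–Hopf solution of
the standing class on `[0,T)` at viscosity `ν` whose inflow Reynolds number `−r u_r/ν` is `≤ d₀` at the points of the
unit tube with `r < ξ₀√(ν(T−t))` and `≤ Λ₀` at those with `r ≥ ξ₀√(ν(T−t))` extends smoothly past `T`.  This removes BOTH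
restrictions of the earlier versions (tree `exists_coreWidth_twoLevelReynolds`: width `ξ₀(d₀,Λ₀) ≥ 1` dictated;
`RadialInflowThinCore.twoLevelReynolds_thinCore`: `Λ₀ < 4`).  Proof: `hasSmoothExtensionPast_of_plateauCoreReynolds` with
the parameters of `exists_plateau_params` (`p = 2 − d₀`); the profile dominates `d₀` everywhere
(`plateauReynolds_ge_core`) and `Λ₀` from `ξ₀` on.  Reading: supercritical inflow (Reynolds number `≥ 2`, any size)
that stays outside an arbitrarily thin parabolic core `r < ξ₀√(ν(T−t))` does not produce a singularity. [new] -/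
theorem twoLevelReynolds_thinCore_anyLevel {d₀ Λ₀ ξ₀ ν T : ℝ}
    {u : ℝ → EuclideanSpace ℝ (Fin 3) → EuclideanSpace ℝ (Fin 3)} {p : ℝ → EuclideanSpace ℝ (Fin 3) → ℝ}
    (hd0 : 0 < d₀) (hd2 : d₀ < 2) (hΛ0 : 0 < Λ₀) (hξ₀ : 0 < ξ₀) (hν : 0 < ν) (hT : 0 < T)
    (hcl : IsClassicalNSSolutionOn (Ico 0 T) ν 0 u p) (hLH : IsLerayHopfOn T ν 0 (u 0) u)
    (hdec : HasRapidSpatialDecay (u 0)) (hax : ∀ t ∈ Ico 0 T, IsAxisymmetric (u t))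
    (hcore : ∀ t ∈ Ico 0 T, ∀ x : EuclideanSpace ℝ (Fin 3), 0 < cylRadius x → cylRadius x ≤ 1 →
      cylRadius x < ξ₀ * √(ν * (T - t)) → -(ν * d₀ / cylRadius x) ≤ radialVelocity (u t) x)
    (hfar : ∀ t ∈ Ico 0 T, ∀ x : EuclideanSpace ℝ (Fin 3), 0 < cylRadius x → cylRadius x ≤ 1 →
      ξ₀ * √(ν * (T - t)) ≤ cylRadius x → -(ν * Λ₀ / cylRadius x) ≤ radialVelocity (u t) x) :
    HasSmoothExtensionPast ν 0 u T := by
  have hp : 0 < 2 - d₀ := by linarith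
  have hp2 : 2 - d₀ < 2 := by linarith
  obtain ⟨m, a, b, L, ε, hm, h2m, ha, hb, hL, hrel, hε, hD⟩ := exists_plateau_params hp hp2 hΛ0 hξ₀
  have hp2' : 2 * m + 2 * a + L * b < 2 := by linarith
  refine hasSmoothExtensionPast_of_plateauCoreReynolds hm h2m ha hb hL hp2' hε hν hT hcl hLH hdec hax
    fun t ht x hx hx1 => ?_
  set lam : ℝ := √(ν * (T - t)) with hlam_def
  have hlam : 0 < lam := Real.sqrt_pos.2 (mul_pos hν (by linarith [ht.2]))
  set ξ : ℝ := cylRadius x / lam with hξ_def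
  have hξ0 : 0 ≤ ξ := div_nonneg (cylRadius_nonneg x) hlam.le
  have hDcore : d₀ ≤ 2 - (2 * m + 2 * a / (1 + (ξ / ε) ^ 2) + b * L / (1 + (ξ / ε) ^ L))
      + (4 * a * (ξ / ε) ^ 2 / (1 + (ξ / ε) ^ 2) ^ 2 + b * L ^ 2 * (ξ / ε) ^ L / (1 + (ξ / ε) ^ L) ^ 2)
        / (2 * m + 2 * a / (1 + (ξ / ε) ^ 2) + b * L / (1 + (ξ / ε) ^ L))
      + ε ^ 2 * (ξ / ε) ^ 2 * ((2 * m + 2 * a / (1 + (ξ / ε) ^ 2) + b * L / (1 + (ξ / ε) ^ L)) - 2 * m)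
        / (2 * (2 * m + 2 * a / (1 + (ξ / ε) ^ 2) + b * L / (1 + (ξ / ε) ^ L))) := by
    have h := plateauReynolds_ge_core hm ha hb hL hε hξ0
    linarith
  have hmono : ∀ K D : ℝ, K ≤ D → -(ν * K / cylRadius x) ≤ radialVelocity (u t) x →
      -(ν * D / cylRadius x) ≤ radialVelocity (u t) x := by
    intro K D hKD hK
    refine le_trans ?_ hK
    rw [neg_le_neg_iff]
    exact div_le_div_of_nonneg_right (mul_le_mul_of_nonneg_left hKD hν.le) hx.le
  by_cases hcr : cylRadius x < ξ₀ * lam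
  · exact hmono _ _ hDcore (hcore t ht x hx hx1 hcr)
  · push Not at hcr
    have hξ₀ξ : ξ₀ ≤ ξ := by rw [hξ_def, le_div_iff₀ hlam]; exact hcr
    exact hmono _ _ (hD ξ hξ₀ξ) (hfar t ht x hx hx1 hcr)

end Summit.NavierStokesRegularity.NavierStokesRegularity.Theorems.RadialInflowPlateau

end
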